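import Summits.Ventures.GridStability.Bench.SMIBDeg6AK13postD10RoaModel
import Summits.Ventures.GridStability.Bench.SMIBDeg6AK13postD10BallB
import HarnessLib

/-!
# G1.SMIB+ «SMIB deg-6» — rider «SMIB-DEG6 BALL-B» (Bernstein enclosure on the manifold-aware signed shell cover K = 8, supersession `_B`) (model half): a gauge ellipsoid of MACHINE STATES `(δ, ω)` around the synchronous
# equilibrium inside the degree-6 certified region, with the ROA sentence from it (parametric SMIB reading and the typed instance of
# record `SMIB.K13postD10`, hypothesis-free)

Venture GRIDFUSION, cell `gridfusion`; seat gridfusion-lyap-2 (g6; declared INSTRUMENT line «T1-KERNEL · BERN»; SUPERSESSION «BALL-B» of the BALL-M pair p562789 / p563434 and of `Bench/SMIBDeg6AK13postD10RoaBallModel.lean` p553144 / `…RoaBallS8Model.lean` p556508 under NEW names: `Bench/SMIBDeg6AK13postD10RoaBallBModel.lean`, declarations suffixed `_B`; earlier files untouched); LOW rider (pattern of «#62′ WSCC9-DEG4-BALL» p544490). Sibling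
of `SMIBDeg6AK13postD10BallB.lean` (recast half: `σ² + κ² + ω²/36 ≤ (3/5)²` ∩ {h = 0} ⊆ {V₆ ≤ 17/7}, Bernstein enclosure on the manifold-aware signed shell cover, one `decide`
per box on `Lyapunov/PolyRecastBernsteinCoeffs`) and of the deg-6 model half `SMIBDeg6AK13postD10RoaModel.lean` (`…_smib_roa` parametric,
`…_K13postD10_roa` hypothesis-free; lyap-2 g4), which it imports; embedding = model-1's `SMIB.embed δs (δ, ω) = (sin u, 1 − cos u,
ω)`, `u = δ − δs`. New facts: `sin²u + (1 − cos u)² ≤ u²` and the packaging; the window hypothesis `|u₀| < π` is discharged by the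
ellipsoid (`u₀² ≤ s² ≤ 2 < π²`).

STATEMENTS. `deg6_A_K13postD10_smib_roa_ball_B`: for ANY SMIB record `p` and equilibrium angle `δs` with the A1′ data relations of
SMIB-K13post-D10 (`a = 532761715096/15538499375`, `b = 4303847457/88791425`, `d = 10/7`, `P_e(δs) = P_m`) and every solution `x =
(δ, ω)` of `p` on `[0, ∞)` with `(δ(0) − δs)² + ω(0)²/36 ≤ (3/5)²`: `V₆ ≤ 17/7` along the recast state and `|δ t − δs| < π` for
all `t ≥ 0` (no pole slip), and `(δ t, ω t) → (δs, 0)`. `deg6_A_K13postD10_K13postD10_roa_ball_B`: the same read on `SMIB.K13postD10`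
(`δs = SMIB.deltaK13`), hypothesis-free. RENDERINGS of `s = 3/5` (VALIDATED column only): rotor angle displaced by ≤ 34.4° at
synchronous speed, or a speed deviation `|ω| ≤ 3.44 rad/s` at the operating angle, or any state on the ellipsoid between.

THREE COLUMNS. CERTIFIED (kernel): the inclusion of the ellipsoid in the certified piece (recast half) + this packaging. MODELLED:
as the parent row G1.SMIB deg-6 (M′ = classical SMIB, Anderson–Fouad (2.40)–(2.42) + damping, Sauer–Pai (5.157), at Kundur 1994 Ex.
13.1 post-fault plant with `K_D = 10` from Ex. 12.2 (iii) — a MODELLED choice; MODEL-VALIDITY MV-1). VALIDATED: only the renderings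
of `s`. No sentence here says a machine or a grid is stable; the ellipsoid is a set of initial states OF THE MODEL M′ inside a
CERTIFICATE's sublevel piece (a box-cover Bernstein-enclosure inner description of it), carried to the synchronous equilibrium of M′
without pole slip — never «the ROA of the system».
-/

namespace Summit.Ventures.GridStability.Bench.SMIB

open Set Filter Metric Topology Real
open Summit.Ventures.GridStability.Lyapunov Summit.Ventures.GridStability.Models
open Literature.Computation.Certificates Literature.Computation.Certificates.SOS

noncomputable section

/-- `sin²u + (1 − cos u)² = 2 − 2cos u ≤ u²` (from `1 − u²/2 ≤ cos u`). [folklore] -/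
private theorem sin_sq_add_one_sub_cos_sq_le' (u : ℝ) : sin u ^ 2 + (1 - cos u) ^ 2 ≤ u ^ 2 := by
  nlinarith [sin_sq_add_cos_sq u, Real.one_sub_sq_div_two_le_cos (x := u)]

/-- **The machine-coordinate ellipsoid lies in the certified piece**: `(δ − δs)² + ω²/36 ≤ (3/5)²` ⇒
`V₆(sin u, 1 − cos u, ω) ≤ 17/7` (`u = δ − δs`). [folklore] -/
theorem deg6_A_K13postD10_V_embed_le_level_of_ball_B (δs : ℝ) (y : ℝ × ℝ)
    (hball : (y.1 - δs) ^ 2 + y.2 ^ 2 / 36 ≤ (3 / 5 : ℝ) ^ 2) :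
    deg6_A_K13postD10_V (sin (y.1 - δs)) (1 - cos (y.1 - δs)) y.2 ≤ deg6_A_K13postD10_level := by
  have hM := deg6_A_K13postD10_embed_mem_M δs y
  have hh : deg6_A_K13postD10_h (sin (y.1 - δs)) (1 - cos (y.1 - δs)) y.2 = 0 := by
    simpa [deg6_A_K13postD10_M] using hM
  have hZ := sin_sq_add_one_sub_cos_sq_le' (y.1 - δs)
  show deg6_A_K13postD10_V (sin (y.1 - δs)) (1 - cos (y.1 - δs)) y.2 ≤ 17 / 7
  exact deg6_A_K13postD10_V_le_level_of_ball_B _ _ _ hh (by linarith)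

/-- The ellipsoid discharges the window hypothesis: `(δ − δs)² + ω²/36 ≤ (3/5)² ≤ 2` ⇒ `|δ − δs| ≤ √2 < π`. [folklore] -/
theorem deg6_A_K13postD10_abs_lt_pi_of_ball_B (δs : ℝ) (y : ℝ × ℝ)
    (hball : (y.1 - δs) ^ 2 + y.2 ^ 2 / 36 ≤ (3 / 5 : ℝ) ^ 2) : |y.1 - δs| < π := by
  have h1 := abs_le_of_sq_le_sq' (show (y.1 - δs) ^ 2 ≤ (2 : ℝ) ^ 2 by nlinarith [sq_nonneg y.2]) (by norm_num)
  exact abs_lt.2 ⟨by linarith [Real.pi_gt_three, h1.1], by linarith [Real.pi_gt_three, h1.2]⟩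

/-- **«SMIB-DEG6 BALL» — parametric SMIB reading.** For ANY SMIB record `p` and equilibrium angle `δs` satisfying the A1′ data
relations of SMIB-K13post-D10 and every solution `x = (δ, ω)` on `[0, ∞)` with `(δ(0) − δs)² + ω(0)²/36 ≤ (3/5)²`: for all `t ≥ 0`,
`V₆ ≤ 17/7` along the recast state and `|δ t − δs| < π` (no pole slip), and `(δ t, ω t) → (δs, 0)`. MODELLED column as in the
module docstring. [folklore] -/
theorem deg6_A_K13postD10_smib_roa_ball_B (p : SMIB) {δs : ℝ} (hM : p.M ≠ 0)
    (ha : ((532761715096/15538499375 : ℚ) : ℝ) = p.PM * cos (δs - p.γ) / p.M)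
    (hb : ((4303847457/88791425 : ℚ) : ℝ) = p.PM * sin (δs - p.γ) / p.M)
    (hd : ((10/7 : ℚ) : ℝ) = p.D / p.M) (hP : p.IsEquilibrium δs)
    {x : ℝ → ℝ × ℝ} (hx : p.IsSolutionOn x (Ici 0))
    (hball : ((x 0).1 - δs) ^ 2 + (x 0).2 ^ 2 / 36 ≤ (3 / 5 : ℝ) ^ 2) :
    (∀ t, 0 ≤ t → deg6_A_K13postD10_V (sin ((x t).1 - δs)) (1 - cos ((x t).1 - δs)) (x t).2 ≤ deg6_A_K13postD10_level ∧
      |(x t).1 - δs| < π) ∧ Tendsto x atTop (𝓝 (δs, 0)) := by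
  have hγ0 : (0 : ℝ) < deg6_A_K13postD10_level := by
    unfold deg6_A_K13postD10_level; norm_num
  exact deg6_A_K13postD10_smib_roa p hM ha hb hd hP hγ0 le_rfl hx (deg6_A_K13postD10_V_embed_le_level_of_ball_B δs (x 0) hball)
    (deg6_A_K13postD10_abs_lt_pi_of_ball_B δs (x 0) hball)

/-- **«SMIB-DEG6 BALL» on the typed instance of record `SMIB.K13postD10`** (`δs = SMIB.deltaK13`; data relations = model-1's kernel
facts `SMIB.K13postD10_relations` / `K13postD10_isEquilibrium`, NO data hypothesis left): every solution on `[0, ∞)` with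
`(δ(0) − δ*)² + ω(0)²/36 ≤ (3/5)²` keeps `V₆ ≤ 17/7`, never pole-slips, and tends to `(δ*, 0)`. MODELLED: MV-1. [folklore] -/
theorem deg6_A_K13postD10_K13postD10_roa_ball_B {x : ℝ → ℝ × ℝ} (hx : SMIB.K13postD10.IsSolutionOn x (Ici 0))
    (hball : ((x 0).1 - SMIB.deltaK13) ^ 2 + (x 0).2 ^ 2 / 36 ≤ (3 / 5 : ℝ) ^ 2) :
    (∀ t, 0 ≤ t → deg6_A_K13postD10_V (sin ((x t).1 - SMIB.deltaK13)) (1 - cos ((x t).1 - SMIB.deltaK13)) (x t).2 ≤ deg6_A_K13postD10_level ∧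
      |(x t).1 - SMIB.deltaK13| < π) ∧ Tendsto x atTop (𝓝 (SMIB.deltaK13, 0)) := by
  obtain ⟨ha, hb, hd⟩ := SMIB.K13postD10_relations
  have hM : SMIB.K13postD10.M ≠ 0 := by simp only [SMIB.K13postD10]; norm_num
  exact deg6_A_K13postD10_smib_roa_ball_B SMIB.K13postD10 hM ha hb hd SMIB.K13postD10_isEquilibrium hx hball

end

end Summit.Ventures.GridStability.Bench.SMIB
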